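import Summits.NavierStokesRegularity.NavierStokesRegularity.Theorems.ExtremiserTransienceNearExtremalTransienceExtremiserLiouvilleConstantSpeedSlideAverage
import HarnessLib

/-!
# Crux `ExtremiserTransience.NearExtremalTransience` (stmt-NavierStokesRegularity-21883), line `extremiser_liouville`,
# stub K1b — vertical sliding AVERAGES are bounded in `L²` (Jensen; record §13 R3′ integrability tool)

`--supports stmt-NavierStokesRegularity-21883` (helper).  Author: prover seat `ns-el-k1b` (g8).  Sequel of `…SlideAverage`:
* `norm_verticalAverage_sq_le` : `‖h⁻¹∫_{−h}^{0}K(x + te₂)dt‖² ≤ h⁻¹∫_{−h}^{0}‖K(x + te₂)‖²dt` (`K` continuous, `h > 0`);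
* `lintegral_verticalAverage_sq_le` : **`∫‖h⁻¹∫_{−h}^{0}K(· + te₂)dt‖² ≤ ∫‖K‖²`** (Tonelli, translation invariance) — so the
  sliding-average terms `Tᵢ` of the palinstrophy integrand (…SlidePalinstrophyPointwise) are square integrable as soon as
  `D²(g′V₂) ∈ L²` (…SlideQuotientL2).

WHAT THIS IS NOT: K1b is NOT proved; nothing here proves NS regularity. [folklore]
-/

noncomputable section

open Set Filter Topology MeasureTheory Metric Function InnerProductSpace
open scoped ENNReal NNReal Topology InnerProductSpace RealInnerProductSpace ContDiff
open Literature.Analysis.FluidPDE Literature.Analysis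

namespace Summit.NavierStokesRegularity.NavierStokesRegularity.Theorems

-- the problem directory repeats the summit name (`NavierStokesRegularity/NavierStokesRegularity`)
set_option linter.dupNamespace false

namespace ExtremiserLiouville

variable {F' : Type*} [NormedAddCommGroup F'] [NormedSpace ℝ F']

/-- **Jensen for the sliding average, pointwise**: `‖h⁻¹∫_{−h}^{0}K(x + te₂)dt‖² ≤ h⁻¹∫_{−h}^{0}‖K(x + te₂)‖²dt`. [folklore] -/
theorem norm_verticalAverage_sq_le {K : EuclideanSpace ℝ (Fin 3) → F'} (hK : Continuous K) {h : ℝ} (hh : 0 < h)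
    (x : EuclideanSpace ℝ (Fin 3)) :
    ‖h⁻¹ • ∫ t in (-h)..0, K (x + t • EuclideanSpace.single (2 : Fin 3) (1 : ℝ))‖ ^ 2 ≤
      h⁻¹ * ∫ t in (-h)..0, ‖K (x + t • EuclideanSpace.single (2 : Fin 3) (1 : ℝ))‖ ^ 2 := by
  set e₂ : EuclideanSpace ℝ (Fin 3) := EuclideanSpace.single (2 : Fin 3) (1 : ℝ) with he₂
  set c' : ℝ → F' := fun t => K (x + t • e₂) with hc'
  have hc'c : Continuous c' := hK.comp (continuous_const.add (continuous_id.smul continuous_const))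
  rw [norm_smul, mul_pow, Real.norm_eq_abs, abs_of_pos (inv_pos.2 hh)]
  have hφ : Continuous fun t => ‖c' t‖ := hc'c.norm
  have hcs := Literature.Geometry.Riemannian.sq_intervalIntegral_le_length_mul_of_continuous hφ (neg_nonpos.2 hh.le)
  simp only [sub_neg_eq_add, zero_add] at hcs
  have hn : ‖∫ t in (-h)..0, c' t‖ ≤ ∫ t in (-h)..0, ‖c' t‖ :=
    intervalIntegral.norm_integral_le_integral_norm (neg_nonpos.2 hh.le)
  calc h⁻¹ ^ 2 * ‖∫ t in (-h)..0, c' t‖ ^ 2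
      ≤ h⁻¹ ^ 2 * (∫ t in (-h)..0, ‖c' t‖) ^ 2 := by gcongr
    _ ≤ h⁻¹ ^ 2 * (h * ∫ t in (-h)..0, ‖c' t‖ ^ 2) := mul_le_mul_of_nonneg_left hcs (sq_nonneg _)
    _ = h⁻¹ * ∫ t in (-h)..0, ‖c' t‖ ^ 2 := by field_simp

/-- **Sliding averages are bounded in `L²`**: `∫‖h⁻¹∫_{−h}^{0}K(· + te₂)dt‖² ≤ ∫‖K‖²` (as lower integrals; `K` continuous,
`h > 0`). [folklore] -/
theorem lintegral_verticalAverage_sq_le [CompleteSpace F'] {K : EuclideanSpace ℝ (Fin 3) → F'} (hK : Continuous K) {h : ℝ} (hh : 0 < h) :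
    ∫⁻ x, ‖h⁻¹ • ∫ t in (-h)..0, K (x + t • EuclideanSpace.single (2 : Fin 3) (1 : ℝ))‖ₑ ^ 2 ≤
      ∫⁻ x, ‖K x‖ₑ ^ 2 := by
  set e₂ : EuclideanSpace ℝ (Fin 3) := EuclideanSpace.single (2 : Fin 3) (1 : ℝ) with he₂
  have cD : Continuous fun p : EuclideanSpace ℝ (Fin 3) × ℝ => K (p.1 + p.2 • e₂) :=
    hK.comp (continuous_fst.add (continuous_snd.smul continuous_const))
  set Φ : EuclideanSpace ℝ (Fin 3) → ℝ → ℝ≥0∞ := fun x t => ‖K (x + t • e₂)‖ₑ ^ 2 with hΦ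
  have hΦm : AEMeasurable (uncurry Φ) ((volume : Measure (EuclideanSpace ℝ (Fin 3))).prod
      ((volume : Measure ℝ).restrict (Ioc (-h) 0))) :=
    ((ENNReal.continuous_pow 2).comp cD.enorm).measurable.aemeasurable
  have hstep : ∀ x, ‖h⁻¹ • ∫ t in (-h)..0, K (x + t • e₂)‖ₑ ^ 2 ≤ ENNReal.ofReal h⁻¹ * ∫⁻ t in Ioc (-h) 0, Φ x t := by
    intro x
    have hc : Continuous fun t : ℝ => ‖K (x + t • e₂)‖ ^ 2 := ((cD.comp (Continuous.prodMk_right x)).norm.pow 2)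
    have hi : IntegrableOn (fun t : ℝ => ‖K (x + t • e₂)‖ ^ 2) (Ioc (-h) 0) volume :=
      (hc.integrableOn_Icc (a := -h) (b := 0)).mono_set Ioc_subset_Icc_self
    rw [← ofReal_norm, ← ENNReal.ofReal_pow (norm_nonneg _)]
    calc ENNReal.ofReal (‖h⁻¹ • ∫ t in (-h)..0, K (x + t • e₂)‖ ^ 2)
        ≤ ENNReal.ofReal (h⁻¹ * ∫ t in (-h)..0, ‖K (x + t • e₂)‖ ^ 2) :=
          ENNReal.ofReal_le_ofReal (norm_verticalAverage_sq_le hK hh x)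
      _ = ENNReal.ofReal h⁻¹ * ∫⁻ t in Ioc (-h) 0, Φ x t := by
          rw [ENNReal.ofReal_mul (inv_nonneg.2 hh.le), intervalIntegral.integral_of_le (neg_nonpos.2 hh.le),
            ofReal_integral_eq_lintegral_ofReal hi (Eventually.of_forall fun t => sq_nonneg _)]
          congr 1
          refine setLIntegral_congr_fun measurableSet_Ioc fun t _ => ?_
          simp only [hΦ]
          rw [ENNReal.ofReal_pow (norm_nonneg _), ofReal_norm]
  have hvol : (volume : Measure ℝ) (Ioc (-h) 0) = ENNReal.ofReal h := by
    rw [Real.volume_Ioc, sub_neg_eq_add, zero_add]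
  have htrans : ∀ t : ℝ, ∫⁻ x, Φ x t = ∫⁻ y, ‖K y‖ₑ ^ 2 := fun t =>
    lintegral_add_right_eq_self (μ := (volume : Measure (EuclideanSpace ℝ (Fin 3)))) (fun y => ‖K y‖ₑ ^ 2) (t • e₂)
  calc ∫⁻ x, ‖h⁻¹ • ∫ t in (-h)..0, K (x + t • e₂)‖ₑ ^ 2
      ≤ ∫⁻ x, ENNReal.ofReal h⁻¹ * ∫⁻ t in Ioc (-h) 0, Φ x t := lintegral_mono hstep
    _ = ENNReal.ofReal h⁻¹ * ∫⁻ x, ∫⁻ t in Ioc (-h) 0, Φ x t := by rw [lintegral_const_mul' _ _ ENNReal.ofReal_ne_top]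
    _ = ENNReal.ofReal h⁻¹ * ∫⁻ t in Ioc (-h) 0, ∫⁻ x, Φ x t := by rw [lintegral_lintegral_swap hΦm]
    _ = ENNReal.ofReal h⁻¹ * ∫⁻ _t in Ioc (-h) 0, ∫⁻ y, ‖K y‖ₑ ^ 2 := by
        congr 1; exact setLIntegral_congr_fun measurableSet_Ioc fun t _ => htrans t
    _ = ∫⁻ y, ‖K y‖ₑ ^ 2 := by
        rw [setLIntegral_const, hvol, mul_comm (∫⁻ y, ‖K y‖ₑ ^ 2) _, ← mul_assoc, ← ENNReal.ofReal_mul (inv_nonneg.2 hh.le),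
          inv_mul_cancel₀ hh.ne', ENNReal.ofReal_one, one_mul]

end ExtremiserLiouville

end Summit.NavierStokesRegularity.NavierStokesRegularity.Theorems

end
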